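import Summits.ABC.IUTFork.DAGC312r
import Summits.ABC.IUTFork.Cor312LogKummerGlobal

/-!
# Kernel DAG index — layer C312, part zb: knitting DELTA 15 — the one node under TEAM B's GLOBAL-QUANTIFIER input (print's quantifier level,
ADJUDICATION-SPEC (G1′)), BY NAME

index v1 · abc-iut-c312-2 (filer, gen 3). PROOF-ONLY, APPEND-ONLY (imports part r and abc-iut-c312-11's `Cor312LogKummerGlobal` — neutral w.r.t.
the co-import breaker B1). Part r catalogued the readings that grant the one remaining node (xi-f): R1 (represented volume, GLOBAL), R2/R3/R4
(PER-PACKET set-level), LANA (9-1), Team B's per-packet `VolumeTransport`/`LinkGluing`, and the identified-copies reading. HOME/plan/ADJUDICATION-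
SPEC.md (G1′) rules that an adjudicating gap statement must be typed at the GLOBAL VOLUME level (the print compares two procession-normalised,
`v_ℚ`-summed numbers; per-packet containments are STRICTLY STRONGER than print and expected false at deep bad places, skel XXIV). Team B's
NAMED global input is `Cor312Vol.GlobalVolumeTransport P` (p414039/`Cor312LogKummerGlobal`): «for some assignment of lattice positions with
finitely supported single-image volumes, `−|log(q)|` ≤ the procession-normalised `v_ℚ`-summed log-volume of the chosen Kummer images of the
Θ-pilot object» — with `GlobalVolumeTransport.statement_of`. This part adds it (and its uniform form `GlobalVolumeTransportAt m₀`) to the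
catalogue: `N_IUTchIII_Cor3_12_pf_xi_f_holds_of_globalVolumeTransport(_at)`, and `xi_f_global_readings` (the two GLOBAL-quantifier sufficient
readings side by side: R1 and Team B's). None asserted. THIS FILE PROVES NOTHING NEW about [IUTchIII] §3 AND ASSERTS NOTHING; no side taken on
Cor. 3.12. typed ≠ discharged; indexed ≠ endorsed. [claim: Mochizuki2012, status: disputed]
-/

noncomputable section

namespace Summit.ABC.IUTFork.DAG

open Cor312Proof Thm311 Cor312Vol Literature.IUT.LogThetaLattice

variable {T : ThetaIndex} (S : FullSituation T) (pending : Locus → Prop) (P : Cor312.Setting S.toSituation)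
  (D : ThetaLinkStrips P.LogLink P.Strip)

/-- **Team B's GLOBAL volume transport grants the node** (print's quantifier level; bridge hypotheses and admissible Kummer images as in
`GlobalVolumeTransport.statement_of`). [claim: Mochizuki2012, status: disputed] -/
theorem N_IUTchIII_Cor3_12_pf_xi_f_holds_of_globalVolumeTransport (hgvt : GlobalVolumeTransport P) (H : BridgeHyps P)
    (hadm : ThetaRegionsAdm P) : N_IUTchIII_Cor3_12_pf_xi_f (lociReadingI S pending) (obsReadingA S pending P D) :=
  N_IUTchIII_Cor3_12_pf_xi_f_holds_of_statement S pending P D (hgvt.statement_of H hadm)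

/-- … uniform form: ONE lattice position `m₀` (in the print the (xi-a) gluing position `m₀ = 0`) for every packet.
[claim: Mochizuki2012, status: disputed] -/
theorem N_IUTchIII_Cor3_12_pf_xi_f_holds_of_globalVolumeTransportAt {m₀ : ℤ} (h : GlobalVolumeTransportAt P m₀) (H : BridgeHyps P)
    (hadm : ThetaRegionsAdm P) : N_IUTchIII_Cor3_12_pf_xi_f (lociReadingI S pending) (obsReadingA S pending P D) :=
  N_IUTchIII_Cor3_12_pf_xi_f_holds_of_statement S pending P D (h.statement_of H hadm)

/-- **THE TWO GLOBAL-QUANTIFIER SUFFICIENT READINGS, side by side** (ADJUDICATION-SPEC (G1′) level): READING 1 (represented volume along a global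
choice of possible images; LANA §8.3) and Team B's global volume transport each grant the one remaining node under the bridge hypotheses.
None asserted; per-packet readings are in part r. [claim: Mochizuki2012, status: disputed] -/
theorem xi_f_global_readings (H : BridgeHyps P) :
    ((∃ U : ImageChoice P, (toLocalFamily P H.mono).assemble.logvol (Set.univ.pi U.1) = P.negLogQ) →
      N_IUTchIII_Cor3_12_pf_xi_f (lociReadingI S pending) (obsReadingA S pending P D)) ∧
    (GlobalVolumeTransport P → ThetaRegionsAdm P → N_IUTchIII_Cor3_12_pf_xi_f (lociReadingI S pending) (obsReadingA S pending P D)) :=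
  ⟨fun h => N_IUTchIII_Cor3_12_pf_xi_f_holds_of_represented S pending P D H h,
    fun hgvt hadm => N_IUTchIII_Cor3_12_pf_xi_f_holds_of_globalVolumeTransport S pending P D hgvt H hadm⟩

end Summit.ABC.IUTFork.DAG

end
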